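import Summits.Ventures.DiscreteObjects.Hadamard.NonCyclicLP333

/-!
# Hadamard 668 census, family F5c — class K09 (`(v, j) ↦ (v, 16 j)`, order 9) in the kernel

Framing: lottery ticket; floor = certified bounds/negative ranges.

Cell pub-namedobj (venture DiscreteObjects), target (H), hadamard gen 4.  Family F5c (gen 3, FAMILY-F5C.md) = Legendre pairs
over the non-cyclic group `G333 = (ZMod 3 × ZMod 3) × ZMod 37` with a common automorphism group `K`; class K09 is
`K = ⟨(v, j) ↦ (v, 16 j)⟩` (order 9; `⟨16⟩ ≤ Z₃₇ˣ` has the four cosets `{1,2,4,8}·⟨16⟩`).  It was decided NONE by the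
two-implementation `F₃²`-compression sieve (2,646 candidates, 0 pairs; verify-ref E2 signed) and by a refereed hand proof
(FAMILY-F5C §10).  This file is the kernel theorem, by a SHORTER argument than the hand proof:

* the `Z₃₇`-compression `e(v) = Σ_j a(v,j)` of a `K`-invariant `±1` array is `a(v,0) + 9(a(v,1)+a(v,2)+a(v,4)+a(v,8))`
  (`comp37_inv16`), so `e(v) ∈ {±1, ±17, ±19, ±35, ±37}`;
* for a Legendre pair, `Σ_v e(v)² + Σ_v f(v)² = 594` (`comp_norm_add`, gen 3), `Σ_v e(v) = Σ a = ±1`, and — the cross form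
  of the compression identity, new here — `PAF_e(u) + PAF_f(u) = -74` for every `u ≠ 0` in `Z₃ × Z₃` (`comp_cross_add`);
* a single letter with `Σ e = ±1` and `Σ e² ≤ 585` is either all `±1` (`Σ e² = 9`) or has exactly two large entries
  `e(p) = -e(q) = ±17` (`Σ e² = 585`) (`letter_structure`): one large entry is incompatible with the row sum, three or a
  larger one with the norm;
* so one letter, say `f`, has `f(p) = -f(q) = ±17` and the other is all `±1`; at the shift `d = q - p ≠ 0` the term
  `f(p) f(q) = -289` of `PAF_f(d)` is accompanied by eight terms each `≤ 17` (no other pair of large entries is at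
  distance `d`, because `2d ≠ 0` in `Z₃ × Z₃`) and `PAF_e(d) ≤ 9`, so `PAF_e(d) + PAF_f(d) ≤ -144 < -74`.

Kernel coverage of the 20 NONE classes of F5c after this file: 15 (all 13 exact-obstruction classes, K15, K09); K05, K06,
K08, K11 (and K17 ⊂ K06) remain two-engine computational.  Ours, not literature; no `sorry`, no `native_decide`.
-/

namespace Summit.Ventures.DiscreteObjects.Hadamard

open Finset BigOperators
open Literature.Combinatorics.Designs.LegendrePairs (PAFOn IsPMOn LegendrePairOn pafOn_zero rowsum_sq_on pm_of_sq)

/-! ### §1 The cross form of the compression identity -/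

/-- cross version of `comp37_normsq`: the autocorrelation of the compression at `u ∈ Z₃ × Z₃` is the sum of the
autocorrelations of the array over the fibre `{u} × Z₃₇`. -/
lemma comp37_cross (c : G333 → ℤ) (u : ZMod 3 × ZMod 3) :
    PAFOn (comp37 c) u = ∑ t : ZMod 37, PAFOn c (u, t) := by
  have hv : ∀ v : ZMod 3 × ZMod 3,
      comp37 c v * comp37 c (v + u) = ∑ t : ZMod 37, ∑ j : ZMod 37, c (v, j) * c (v + u, j + t) := by
    intro v
    unfold comp37
    have h1 : ∀ j : ZMod 37, ∑ t, c (v, j) * c (v + u, j + t) = ∑ j', c (v, j) * c (v + u, j') := fun j => by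
      have := Equiv.sum_comp (Equiv.addLeft j) (fun j' => c (v, j) * c (v + u, j'))
      simpa only [Equiv.coe_addLeft] using this
    calc (∑ j, c (v, j)) * (∑ j', c (v + u, j')) = ∑ j, ∑ j', c (v, j) * c (v + u, j') := by
          rw [Finset.sum_mul_sum]
      _ = ∑ j, ∑ t, c (v, j) * c (v + u, j + t) := Finset.sum_congr rfl fun j _ => (h1 j).symm
      _ = ∑ t, ∑ j, c (v, j) * c (v + u, j + t) := Finset.sum_comm
  unfold PAFOn
  simp_rw [hv]
  rw [Finset.sum_comm]
  refine Finset.sum_congr rfl fun t _ => ?_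
  rw [Fintype.sum_prod_type (f := fun h : G333 => c h * c (h + (u, t)))]
  refine Finset.sum_congr rfl fun v _ => Finset.sum_congr rfl fun j _ => ?_
  simp only [Prod.mk_add_mk]

/-- for a Legendre pair over `G333` and `u ≠ 0` in `Z₃ × Z₃`: `PAF_e(u) + PAF_f(u) = 37 · (-2) = -74`. -/
lemma comp_cross_add (a b : G333 → ℤ) (h : LegendrePairOn a b) (u : ZMod 3 × ZMod 3) (hu : u ≠ 0) :
    PAFOn (comp37 a) u + PAFOn (comp37 b) u = -74 := by
  rw [comp37_cross, comp37_cross, ← Finset.sum_add_distrib]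
  have key : ∀ t : ZMod 37, PAFOn a (u, t) + PAFOn b (u, t) = -2 := fun t =>
    h.2.2 _ (by intro hc; exact hu (Prod.mk.inj hc).1)
  rw [Finset.sum_congr rfl (fun t _ => key t), Finset.sum_const, Finset.card_univ, ZMod.card]
  norm_num

/-- the row sum of the array is the row sum of its compression. -/
lemma sum_comp37 (c : G333 → ℤ) : ∑ h, c h = ∑ v, comp37 c v := by
  unfold comp37; rw [Fintype.sum_prod_type]

/-! ### §2 Arrays invariant under `j ↦ 16 j` -/

/-- `ZMod 37 = {0} ∪ 16^ℕ ∪ 2·16^ℕ ∪ 4·16^ℕ ∪ 8·16^ℕ` (`16 = 2⁴` generates the subgroup of index `4` of `Z₃₇ˣ`). -/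
lemma sum_Z37_split16 (f : ZMod 37 → ℤ) :
    ∑ j, f j = f 0 + ∑ k : Fin 9, f (16 ^ (k : ℕ)) + ∑ k : Fin 9, f (2 * 16 ^ (k : ℕ)) +
      ∑ k : Fin 9, f (4 * 16 ^ (k : ℕ)) + ∑ k : Fin 9, f (8 * 16 ^ (k : ℕ)) := by
  have hU : (Finset.univ : Finset (ZMod 37)) =
      {0} ∪ (Finset.univ.image fun k : Fin 9 => (16 : ZMod 37) ^ (k : ℕ)) ∪
        (Finset.univ.image fun k : Fin 9 => 2 * (16 : ZMod 37) ^ (k : ℕ)) ∪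
        (Finset.univ.image fun k : Fin 9 => 4 * (16 : ZMod 37) ^ (k : ℕ)) ∪
        (Finset.univ.image fun k : Fin 9 => 8 * (16 : ZMod 37) ^ (k : ℕ)) := by decide
  have hd1 : Disjoint ({0} : Finset (ZMod 37)) (Finset.univ.image fun k : Fin 9 => (16 : ZMod 37) ^ (k : ℕ)) := by
    decide
  have hd2 : Disjoint (({0} : Finset (ZMod 37)) ∪ (Finset.univ.image fun k : Fin 9 => (16 : ZMod 37) ^ (k : ℕ)))
      (Finset.univ.image fun k : Fin 9 => 2 * (16 : ZMod 37) ^ (k : ℕ)) := by decide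
  have hd3 : Disjoint (({0} : Finset (ZMod 37)) ∪ (Finset.univ.image fun k : Fin 9 => (16 : ZMod 37) ^ (k : ℕ))
      ∪ (Finset.univ.image fun k : Fin 9 => 2 * (16 : ZMod 37) ^ (k : ℕ)))
      (Finset.univ.image fun k : Fin 9 => 4 * (16 : ZMod 37) ^ (k : ℕ)) := by decide
  have hd4 : Disjoint (({0} : Finset (ZMod 37)) ∪ (Finset.univ.image fun k : Fin 9 => (16 : ZMod 37) ^ (k : ℕ))
      ∪ (Finset.univ.image fun k : Fin 9 => 2 * (16 : ZMod 37) ^ (k : ℕ))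
      ∪ (Finset.univ.image fun k : Fin 9 => 4 * (16 : ZMod 37) ^ (k : ℕ)))
      (Finset.univ.image fun k : Fin 9 => 8 * (16 : ZMod 37) ^ (k : ℕ)) := by decide
  have hi1 : Function.Injective fun k : Fin 9 => (16 : ZMod 37) ^ (k : ℕ) := by decide
  have hi2 : Function.Injective fun k : Fin 9 => 2 * (16 : ZMod 37) ^ (k : ℕ) := by decide
  have hi4 : Function.Injective fun k : Fin 9 => 4 * (16 : ZMod 37) ^ (k : ℕ) := by decide
  have hi8 : Function.Injective fun k : Fin 9 => 8 * (16 : ZMod 37) ^ (k : ℕ) := by decide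
  rw [hU, Finset.sum_union hd4, Finset.sum_union hd3, Finset.sum_union hd2, Finset.sum_union hd1,
    Finset.sum_singleton, Finset.sum_image (fun x _ y _ h => hi1 h), Finset.sum_image (fun x _ y _ h => hi2 h),
    Finset.sum_image (fun x _ y _ h => hi4 h), Finset.sum_image (fun x _ y _ h => hi8 h)]

/-- invariance under `j ↦ 16 j` makes the array constant on `16^ℕ · j₀`. -/
lemma inv16_pow (c : G333 → ℤ) (hc : ∀ v j, c (v, 16 * j) = c (v, j)) (v : ZMod 3 × ZMod 3) (j₀ : ZMod 37) :
    ∀ k : ℕ, c (v, 16 ^ k * j₀) = c (v, j₀) := by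
  intro k
  induction k with
  | zero => simp
  | succ k ih => rw [pow_succ, mul_comm (16 ^ k : ZMod 37) 16, mul_assoc, hc, ih]

/-- the compression of a `(j ↦ 16 j)`-invariant array: `e(v) = c(v,0) + 9 (c(v,1) + c(v,2) + c(v,4) + c(v,8))`. -/
lemma comp37_inv16 (c : G333 → ℤ) (hc : ∀ v j, c (v, 16 * j) = c (v, j)) (v : ZMod 3 × ZMod 3) :
    comp37 c v = c (v, 0) + 9 * (c (v, 1) + c (v, 2) + c (v, 4) + c (v, 8)) := by
  unfold comp37
  rw [sum_Z37_split16]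
  have h1 : ∀ k : Fin 9, c (v, 16 ^ (k : ℕ)) = c (v, 1) := fun k => by
    have := inv16_pow c hc v 1 k; rwa [mul_one] at this
  have h2 : ∀ k : Fin 9, c (v, 2 * 16 ^ (k : ℕ)) = c (v, 2) := fun k => by
    have := inv16_pow c hc v 2 k; rwa [mul_comm] at this
  have h4 : ∀ k : Fin 9, c (v, 4 * 16 ^ (k : ℕ)) = c (v, 4) := fun k => by
    have := inv16_pow c hc v 4 k; rwa [mul_comm] at this
  have h8 : ∀ k : Fin 9, c (v, 8 * 16 ^ (k : ℕ)) = c (v, 8) := fun k => by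
    have := inv16_pow c hc v 8 k; rwa [mul_comm] at this
  simp only [h1, h2, h4, h8, Finset.sum_const, Finset.card_univ, Fintype.card_fin]
  ring

/-- the values of the compression of a `±1` array invariant under `j ↦ 16 j`: `e(v)² ∈ {1, 289, 361, 1225, 1369}`,
recorded as the three facts used below. -/
lemma comp37_inv16_facts (c : G333 → ℤ) (hpm : IsPMOn c) (hc : ∀ v j, c (v, 16 * j) = c (v, j))
    (v : ZMod 3 × ZMod 3) :
    (comp37 c v ^ 2 = 1 ∨ 289 ≤ comp37 c v ^ 2) ∧ (comp37 c v ^ 2 ≤ 289 → comp37 c v ^ 2 = 1 ∨ comp37 c v ^ 2 = 289)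
      ∧ (comp37 c v ^ 2 = 289 → comp37 c v = 17 ∨ comp37 c v = -17) := by
  rw [comp37_inv16 c hc v]
  rcases hpm (v, 0) with h0 | h0 <;> rcases hpm (v, 1) with h1 | h1 <;> rcases hpm (v, 2) with h2 | h2 <;>
    rcases hpm (v, 4) with h4 | h4 <;> rcases hpm (v, 8) with h8 | h8 <;> rw [h0, h1, h2, h4, h8] <;> norm_num

/-! ### §3 One letter: all `±1`, or exactly two opposite entries `±17` -/

/-- a `±1`-valued square means a `±1` value. -/
private lemma pm_of_sq_eq_one {x : ℤ} (h : x ^ 2 = 1) : x = 1 ∨ x = -1 := by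
  have h1 : (x - 1) * (x + 1) = 0 := by ring_nf; linarith
  rcases mul_eq_zero.mp h1 with h2 | h2
  · left; linarith
  · right; linarith

/-- an integer with `x² = 1` has `|x| ≤ 1`, written as two inequalities. -/
private lemma bounds_of_sq_eq_one {x : ℤ} (h : x ^ 2 = 1) : -1 ≤ x ∧ x ≤ 1 := by
  rcases pm_of_sq_eq_one h with rfl | rfl <;> norm_num

/-- **Structure of one letter.**  Let `x : Z₃ × Z₃ → ℤ` have every `x(v)² = 1` or `≥ 289`, with `x(v)² ≤ 289 ⇒ x(v)² ∈ {1, 289}`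
and `x(v)² = 289 ⇒ x(v) = ±17`; suppose `Σ x = ±1` and `Σ x² ≤ 585`.  Then either all `x(v)² = 1`, or there are `p ≠ q`
with `x p = -x q`, `x(p)² = 289`, and `x(v)² = 1` for every other `v`. -/
lemma letter_structure (x : ZMod 3 × ZMod 3 → ℤ)
    (hval : ∀ v, (x v ^ 2 = 1 ∨ 289 ≤ x v ^ 2) ∧ (x v ^ 2 ≤ 289 → x v ^ 2 = 1 ∨ x v ^ 2 = 289)
      ∧ (x v ^ 2 = 289 → x v = 17 ∨ x v = -17))
    (hrow : ∑ v, x v = 1 ∨ ∑ v, x v = -1) (hnorm : ∑ v, x v ^ 2 ≤ 585) :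
    (∀ v, x v ^ 2 = 1) ∨
      ∃ p q, p ≠ q ∧ x p = -x q ∧ x p ^ 2 = 289 ∧ ∀ v, v ≠ p → v ≠ q → x v ^ 2 = 1 := by
  classical
  -- the set of large entries
  set B : Finset (ZMod 3 × ZMod 3) := Finset.univ.filter (fun v => x v ^ 2 ≠ 1) with hB
  have hmemB : ∀ v, v ∈ B ↔ x v ^ 2 ≠ 1 := fun v => by simp [hB]
  have hbig : ∀ v ∈ B, 289 ≤ x v ^ 2 := fun v hv => ((hval v).1).resolve_left ((hmemB v).1 hv)
  have hsmall : ∀ v, v ∉ B → x v ^ 2 = 1 := fun v hv => by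
    by_contra h; exact hv ((hmemB v).2 h)
  -- Σ x² = Σ_B x² + |Bᶜ|
  have hsplit : ∑ v, x v ^ 2 = ∑ v ∈ B, x v ^ 2 + ∑ v ∈ Bᶜ, x v ^ 2 :=
    (Finset.sum_add_sum_compl B _).symm
  have hcompl : ∑ v ∈ Bᶜ, x v ^ 2 = (Bᶜ.card : ℤ) := by
    rw [Finset.sum_congr rfl (fun v hv => hsmall v (Finset.mem_compl.mp hv))]
    simp
  have hB9 : B.card ≤ 9 := by
    have := Finset.card_le_univ B; simpa [ZMod.card] using this
  have hcardc : (Bᶜ.card : ℤ) = 9 - B.card := by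
    have h := Finset.card_compl B
    have h9 : Fintype.card (ZMod 3 × ZMod 3) = 9 := by simp [ZMod.card]
    rw [h9] at h
    omega
  have hBsum : 289 * (B.card : ℤ) ≤ ∑ v ∈ B, x v ^ 2 := by
    have := Finset.sum_le_sum (fun v hv => hbig v hv)
    simpa [Finset.sum_const, mul_comm] using this
  have hcard_le : B.card ≤ 2 := by
    have : 289 * (B.card : ℤ) + (9 - B.card) ≤ 585 := by linarith
    omega
  -- case analysis on |B|
  rcases Nat.lt_or_ge B.card 1 with h0 | h1
  · -- |B| = 0: all small
    left
    intro v
    apply hsmall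
    intro hv
    have : B.card ≠ 0 := Finset.card_ne_zero.mpr ⟨v, hv⟩
    omega
  · rcases Nat.lt_or_ge B.card 2 with h1' | h2
    · -- |B| = 1: the row sum is off by at least 9
      exfalso
      obtain ⟨p, hp⟩ := Finset.card_eq_one.mp (by omega : B.card = 1)
      have hpB : p ∈ B := by rw [hp]; exact Finset.mem_singleton_self p
      have hothers : ∀ v, v ≠ p → x v ^ 2 = 1 := fun v hv => hsmall v (by rw [hp]; simpa using hv)
      have hrow' : ∑ v, x v = x p + ∑ v ∈ Finset.univ.erase p, x v :=
        (Finset.add_sum_erase _ _ (Finset.mem_univ p)).symm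
      have hrest : -8 ≤ ∑ v ∈ Finset.univ.erase p, x v ∧ ∑ v ∈ Finset.univ.erase p, x v ≤ 8 := by
        constructor
        · have := Finset.sum_le_sum (s := Finset.univ.erase p)
            (fun v hv => (bounds_of_sq_eq_one (hothers v (Finset.ne_of_mem_erase hv))).1)
          simpa [Finset.sum_const, Finset.card_erase_of_mem, ZMod.card] using this
        · have := Finset.sum_le_sum (s := Finset.univ.erase p)
            (fun v hv => (bounds_of_sq_eq_one (hothers v (Finset.ne_of_mem_erase hv))).2)
          simpa [Finset.sum_const, Finset.card_erase_of_mem, ZMod.card] using this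
      have hp2 : 289 ≤ x p ^ 2 := hbig p hpB
      have hpabs : 17 ≤ x p ∨ x p ≤ -17 := by
        by_contra hc
        push Not at hc
        nlinarith [hc.1, hc.2]
      rcases hrow with hr | hr <;> rcases hpabs with ha | ha <;> linarith [hrest.1, hrest.2]
    · -- |B| = 2
      right
      have hB2 : B.card = 2 := by omega
      obtain ⟨p, q, hpq, hpq'⟩ := Finset.card_eq_two.mp hB2
      have hpB : p ∈ B := by rw [hpq']; simp
      have hqB : q ∈ B := by rw [hpq']; simp
      have hothers : ∀ v, v ≠ p → v ≠ q → x v ^ 2 = 1 := fun v hv hv' =>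
        hsmall v (by rw [hpq']; simp [hv, hv'])
      -- norms: x p² + x q² ≤ 585 - 7
      have hBsum2 : ∑ v ∈ B, x v ^ 2 = x p ^ 2 + x q ^ 2 := by rw [hpq', Finset.sum_pair hpq]
      have hn : x p ^ 2 + x q ^ 2 ≤ 578 := by
        have : (Bᶜ.card : ℤ) = 7 := by rw [hcardc, hB2]; norm_num
        linarith
      have hp289 : x p ^ 2 = 289 := by
        rcases (hval p).2.1 (by nlinarith [hbig q hqB]) with h | h
        · exact absurd h ((hmemB p).1 hpB)
        · exact h
      have hq289 : x q ^ 2 = 289 := by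
        rcases (hval q).2.1 (by nlinarith [hbig p hpB]) with h | h
        · exact absurd h ((hmemB q).1 hqB)
        · exact h
      -- row sum: x p + x q + (7 signs) = ±1 forces x p = -x q
      have hrow' : ∑ v, x v = x p + (x q + ∑ v ∈ (Finset.univ.erase p).erase q, x v) := by
        rw [← Finset.add_sum_erase _ _ (Finset.mem_univ p), ← Finset.add_sum_erase _ _ (by simp [hpq.symm] : q ∈ Finset.univ.erase p)]
      have hrest : -7 ≤ ∑ v ∈ (Finset.univ.erase p).erase q, x v ∧ ∑ v ∈ (Finset.univ.erase p).erase q, x v ≤ 7 := by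
        have hmem : ∀ v ∈ (Finset.univ.erase p).erase q, v ≠ p ∧ v ≠ q := fun v hv =>
          ⟨Finset.ne_of_mem_erase (Finset.mem_of_mem_erase hv), Finset.ne_of_mem_erase hv⟩
        have hcard7 : ((Finset.univ.erase p).erase q).card = 7 := by
          rw [Finset.card_erase_of_mem (by simp [hpq.symm]), Finset.card_erase_of_mem (Finset.mem_univ p)]
          simp [ZMod.card]
        constructor
        · have := Finset.sum_le_sum (s := (Finset.univ.erase p).erase q)
            (fun v hv => (bounds_of_sq_eq_one (hothers v (hmem v hv).1 (hmem v hv).2)).1)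
          simpa [Finset.sum_const, hcard7] using this
        · have := Finset.sum_le_sum (s := (Finset.univ.erase p).erase q)
            (fun v hv => (bounds_of_sq_eq_one (hothers v (hmem v hv).1 (hmem v hv).2)).2)
          simpa [Finset.sum_const, hcard7] using this
      have hp17 := (hval p).2.2 hp289
      have hq17 := (hval q).2.2 hq289
      refine ⟨p, q, hpq, ?_, hp289, hothers⟩
      rcases hp17 with hp17 | hp17 <;> rcases hq17 with hq17 | hq17 <;> rcases hrow with hr | hr <;>
        first | (norm_num [hp17, hq17]; done) | (exfalso; rw [hrow', hp17, hq17] at hr; linarith [hrest.1, hrest.2])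

/-! ### §4 The final inequality at the shift `d = q - p` -/

/-- in `Z₃ × Z₃` doubling is injective: `d + d = 0 → d = 0`. -/
private lemma two_torsion_free (d : ZMod 3 × ZMod 3) (h : d + d = 0) : d = 0 := by
  revert d; decide

/-- the product of two `±1` values is at most `1`. -/
private lemma mul_le_one_of_sq {x y : ℤ} (hx : x ^ 2 = 1) (hy : y ^ 2 = 1) : x * y ≤ 1 := by
  rcases pm_of_sq_eq_one hx with rfl | rfl <;> rcases pm_of_sq_eq_one hy with rfl | rfl <;> norm_num

/-- **the shift-`d` inequality.**  If `x` is all `±1` and `y` has `y(p) = -y(q) = ±17` (`p ≠ q`) and is `±1` elsewhere,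
then `PAF_x(q - p) + PAF_y(q - p) ≤ -144`; in particular it is not `-74`. -/
lemma cross_at_d_ne (x y : ZMod 3 × ZMod 3 → ℤ) (hx : ∀ v, x v ^ 2 = 1) (p q : ZMod 3 × ZMod 3) (hpq : p ≠ q)
    (hy : y p = -y q) (hyp : y p ^ 2 = 289) (hys : ∀ v, v ≠ p → v ≠ q → y v ^ 2 = 1) :
    PAFOn x (q - p) + PAFOn y (q - p) ≠ -74 := by
  -- PAF_x(d) ≤ 9
  have hX : PAFOn x (q - p) ≤ 9 := by
    unfold PAFOn
    have := Finset.sum_le_sum (s := Finset.univ) (fun v _ => mul_le_one_of_sq (hx v) (hx (v + (q - p))))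
    simpa [Finset.sum_const, ZMod.card] using this
  -- the large term of PAF_y(d)
  have hyq : y q ^ 2 = 289 := by rw [show y q = -y p by rw [hy]; ring] ; rw [neg_sq]; exact hyp
  have hpq_term : y p * y (p + (q - p)) = -289 := by
    rw [show p + (q - p) = q by abel, hy]; nlinarith [hyq]
  -- every other term is at most 17
  have habs17 : ∀ v, y v ≤ 17 ∧ -17 ≤ y v := by
    intro v
    by_cases hvp : v = p
    · subst hvp; constructor <;> nlinarith [hyp]
    by_cases hvq : v = q
    · subst hvq; constructor <;> nlinarith [hyq]
    have := bounds_of_sq_eq_one (hys v hvp hvq)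
    constructor <;> linarith [this.1, this.2]
  have hterm : ∀ v ∈ Finset.univ.erase p, y v * y (v + (q - p)) ≤ 17 := by
    intro v hv
    have hvp : v ≠ p := Finset.ne_of_mem_erase hv
    by_cases hvq : v = q
    · -- v = q: then v + d ∉ {p, q}
      subst hvq
      have h1 : v + (v - p) ≠ p := by
        intro hc; apply hpq
        have : (v - p) + (v - p) = 0 := by
          have := congrArg (fun w => w - p) hc; simp at this; linear_combination this
        have := two_torsion_free _ this
        exact (sub_eq_zero.mp this).symm
      have h2 : v + (v - p) ≠ v := by
        intro hc; apply hpq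
        have : v - p = 0 := by simpa using hc
        exact (sub_eq_zero.mp this).symm
      have hs := bounds_of_sq_eq_one (hys _ h1 h2)
      rcases le_or_gt 0 (y v) with hvn | hvn
      · nlinarith [hs.1, hs.2, (habs17 v).1]
      · nlinarith [hs.1, hs.2, (habs17 v).2]
    · have hs := bounds_of_sq_eq_one (hys v hvp hvq)
      have hb := habs17 (v + (q - p))
      rcases le_or_gt 0 (y (v + (q - p))) with hvn | hvn
      · nlinarith [hs.1, hs.2, hb.1]
      · nlinarith [hs.1, hs.2, hb.2]
  have hY : PAFOn y (q - p) ≤ -289 + 8 * 17 := by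
    unfold PAFOn
    rw [← Finset.add_sum_erase _ _ (Finset.mem_univ p), hpq_term]
    have := Finset.sum_le_sum hterm
    have hcard : (Finset.univ.erase p).card = 8 := by
      rw [Finset.card_erase_of_mem (Finset.mem_univ p)]; simp [ZMod.card]
    rw [Finset.sum_const, hcard, nsmul_eq_mul] at this
    push_cast at this
    linarith
  linarith

/-! ### §5 Class K09: NONE -/

/-- **Family F5c, class K09 (`K = ⟨(v, j) ↦ (v, 16 j)⟩`, order 9): NONE.**  No Legendre pair over the non-cyclic group
`G333 = (Z₃ × Z₃) × Z₃₇` has both arrays invariant under `(v, j) ↦ (v, 16 j)`; hence no Hadamard matrix of order 668 arises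
from two `G333`-developed cores with that symmetry.  (Ours; the cyclic analogue — multiplier group `⟨16⟩` of order 9 on
`Z₃₃₃`, arXiv:2607.20765 Table A1 row 12 — is closed in print by enumeration; this argument uses `2d ≠ 0` in `Z₃ × Z₃`.) -/
theorem no_legendrePairOn_G333_inv16 (a b : G333 → ℤ) (ha : ∀ v j, a (v, 16 * j) = a (v, j))
    (hb : ∀ v j, b (v, 16 * j) = b (v, j)) : ¬ LegendrePairOn a b := by
  intro h
  have hsum := comp_norm_add a b h
  -- row sums ±1
  have hra : ∑ v, comp37 a v = 1 ∨ ∑ v, comp37 a v = -1 := by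
    rw [← sum_comp37]; exact pm_of_sq _ _ (rowsum_sq_on a b h)
  have hrb : ∑ v, comp37 b v = 1 ∨ ∑ v, comp37 b v = -1 := by
    rw [← sum_comp37]
    have h2 := rowsum_sq_on a b h
    exact pm_of_sq _ _ (by linarith [h2] : (∑ i, b i) ^ 2 + (∑ i, a i) ^ 2 = 2)
  -- each norm is ≥ 9, hence ≤ 585
  have hge : ∀ c : G333 → ℤ, IsPMOn c → (∀ v j, c (v, 16 * j) = c (v, j)) → 9 ≤ ∑ v, comp37 c v ^ 2 := by
    intro c hc hinv
    have h1 : ∀ v, (1 : ℤ) ≤ comp37 c v ^ 2 := fun v => by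
      rcases (comp37_inv16_facts c hc hinv v).1 with h | h <;> linarith
    have := Finset.sum_le_sum (s := Finset.univ) (fun v _ => h1 v)
    simpa [ZMod.card] using this
  have hna : ∑ v, comp37 a v ^ 2 ≤ 585 := by linarith [hge b h.2.1 hb]
  have hnb : ∑ v, comp37 b v ^ 2 ≤ 585 := by linarith [hge a h.1 ha]
  have hsa := letter_structure (comp37 a) (comp37_inv16_facts a h.1 ha) hra hna
  have hsb := letter_structure (comp37 b) (comp37_inv16_facts b h.2.1 hb) hrb hnb
  -- norms of an all-±1 letter and of a two-17 letter
  have nine : ∀ x : ZMod 3 × ZMod 3 → ℤ, (∀ v, x v ^ 2 = 1) → ∑ v, x v ^ 2 = 9 := fun x hx => by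
    rw [Finset.sum_congr rfl (fun v _ => hx v)]; simp [ZMod.card]
  rcases hsa with hsa | ⟨p, q, hpq, hopp, hp2, hrest⟩ <;> rcases hsb with hsb | ⟨p', q', hpq', hopp', hp2', hrest'⟩
  · -- both small: 9 + 9 ≠ 594
    have := nine _ hsa; have := nine _ hsb; linarith
  · -- a small, b has the two 17s: look at d = q' - p'
    have hd : q' - p' ≠ 0 := fun hc => hpq' (sub_eq_zero.mp hc).symm
    have hc := comp_cross_add a b h (q' - p') hd
    exact cross_at_d_ne (comp37 a) (comp37 b) hsa p' q' hpq' hopp' hp2' hrest' hc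
  · -- b small, a has the two 17s
    have hd : q - p ≠ 0 := fun hc => hpq (sub_eq_zero.mp hc).symm
    have hc := comp_cross_add a b h (q - p) hd
    rw [add_comm] at hc
    exact cross_at_d_ne (comp37 b) (comp37 a) hsb p q hpq hopp hp2 hrest hc
  · -- both letters have two 17s: norms 585 + 585 ≠ 594
    have h7 : ∀ (x : ZMod 3 × ZMod 3 → ℤ) (p q : ZMod 3 × ZMod 3), p ≠ q → x p = -x q → x p ^ 2 = 289 →
        (∀ v, v ≠ p → v ≠ q → x v ^ 2 = 1) → 578 ≤ ∑ v, x v ^ 2 := by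
      intro x p q hpq hopp hp2 _
      have hq2 : x q ^ 2 = 289 := by
        have : x q = -x p := by rw [hopp]; ring
        rw [this, neg_sq, hp2]
      have h2 : ∑ v ∈ ({p, q} : Finset _), x v ^ 2 ≤ ∑ v, x v ^ 2 :=
        Finset.sum_le_sum_of_subset_of_nonneg (Finset.subset_univ _) (fun v _ _ => sq_nonneg (x v))
      rw [Finset.sum_pair hpq, hp2, hq2] at h2
      linarith
    have := h7 _ p q hpq hopp hp2 hrest
    have := h7 _ p' q' hpq' hopp' hp2' hrest'
    linarith

end Summit.Ventures.DiscreteObjects.Hadamard
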